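import Mathlib
import Literature.AlgebraicGeometry.Resolution.CossartFunctionNormalForm3
import Literature.AlgebraicGeometry.Resolution.RegularSystemOfParameters
import HarnessLib

/-!
# Route `RadicialJung`, crux `CleanModels` (stmt-15917), stub 3 (`stub_cossart1987Thm`, F-112) — basics of Cossart's
# pointwise «`ν = 0`» predicate `NuZeroAt` (Posva 2024, App. A, Claim A.1.1 read at a point; the points of dimension `≤ 1`)

Def-free helper lemmas about the Literature predicate `Literature.AlgebraicGeometry.Resolution.NuZeroAt`
(`CossartFunctionNormalForm3.lean`), the pointwise conclusion of the printed theorems `Cossart1987Thm` /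
`Cossart1987ThmRational` (F-112).  OURS, elementary; nothing here proves resolution of singularities in characteristic `p`
and nothing here proves F-112.  What is recorded:

* `nuZeroAt_iff_of_forall_derivation_eq_mul` — if every derivation `D` has `D f' = u · D f` for a unit `u`, then
  `NuZeroAt f' ↔ NuZeroAt f` (the log-Jacobian sets differ by the unit `u`, so they span the same ideal).
* `derivation_unit_pow_mul_add_pow` — in characteristic `p`, `D (φ^p · f + g^p) = φ^p · D f` for every derivation.
* `nuZeroAt_unit_pow_mul_add_pow_iff` — **Posva 2024 Claim A.1.1 at a point**: for a unit `φ` and any `g`,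
  `NuZeroAt (φ^p · f + g^p) ↔ NuZeroAt f` (the ideal `𝒥` and hence `ν` are unchanged by `f ⇝ φ^p f`, and by adding
  `p`-th powers); corollaries `nuZeroAt_add_pow_iff`, `nuZeroAt_unit_pow_mul_iff`.  (For a NON-unit `φ` the
  equivalence fails at a point — witness (β) of `Cruxes/CleanModels/Lines/Sketch-memo-hand1-g26.md`.)
* `nuZeroAt_of_isUnit_derivation` — at a regular local ring, if some derivation takes a UNIT value on `f`
  (the Jacobian ideal of `f` is `(1)`), then `NuZeroAt f` (empty boundary, `e = 0`).
* `nuZeroAt_of_isField` — at a field (the generic point), `NuZeroAt f` as soon as some `D f ≠ 0`.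
* `nuZeroAt_of_isDiscreteValuationRing` — at a discrete valuation ring (points of codimension one), `NuZeroAt f` as
  soon as some `D f ≠ 0`: with `t = (ϖ)` and `e = 1`, the log-Jacobian ideal is a non-zero ideal, hence `(ϖ^b)`.
* `exists_derivation_apply_ne_zero_of_nuZeroAt` — conversely, in a Noetherian local domain `NuZeroAt f` forces some
  `D f ≠ 0` (Krull: `dim S ≤ μ(𝔪)`); `nuZeroAt_iff_of_isDiscreteValuationRing`, `nuZeroAt_iff_of_isField`.
So the pointwise obligation of F-112 is void at all points of dimension `≤ 1` carrying a derivation with `D f ≠ 0`;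
Cossart's algorithm is about the points of dimension `2` and `3`.

[cite: Posva2024, App. A Claim A.1.1 and §A.1.1] [folklore]
-/

noncomputable section

-- `Summit.<S>.<S>.…` duplicates the summit name by design (single-problem summit).
set_option linter.dupNamespace false

open IsLocalRing
open Literature.AlgebraicGeometry.Resolution

namespace Summit.ResolutionOfSingularities.ResolutionOfSingularities.Theorems.RadicialJung.CleanModels.NuZeroAtBasics

variable {S : Type} [CommRing S]

/-- Multiplying a generating set by a unit does not change the ideal it spans. [folklore] -/
theorem span_image_mul_eq_of_isUnit {u : S} (hu : IsUnit u) (T : Set S) :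
    Ideal.span ((fun v => u * v) '' T) = Ideal.span T := by
  apply le_antisymm
  · rw [Ideal.span_le]
    rintro _ ⟨v, hv, rfl⟩
    exact Ideal.mul_mem_left _ u (Ideal.subset_span hv)
  · rw [Ideal.span_le]
    intro v hv
    obtain ⟨w, hw⟩ := hu
    have : v = (↑w⁻¹ : S) * (u * v) := by rw [← hw, ← mul_assoc, Units.inv_mul, one_mul]
    rw [SetLike.mem_coe, this]
    exact Ideal.mul_mem_left _ _ (Ideal.subset_span ⟨v, hv, rfl⟩)

/-- If every derivation `D` of `S` satisfies `D f' = u · D f` for a unit `u`, then the log-Jacobian ideals of `f'` and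
`f` (w.r.t. any boundary) coincide, so `NuZeroAt f' ↔ NuZeroAt f`. [folklore] -/
theorem nuZeroAt_iff_of_forall_derivation_eq_mul [IsLocalRing S] {f f' u : S} (hu : IsUnit u)
    (h : ∀ D : Derivation ℤ S S, D f' = u * D f) : NuZeroAt f' ↔ NuZeroAt f := by
  have hset : ∀ (P : Derivation ℤ S S → Prop),
      {v : S | ∃ D : Derivation ℤ S S, P D ∧ D f' = v} =
        (fun v => u * v) '' {v : S | ∃ D : Derivation ℤ S S, P D ∧ D f = v} := by
    intro P
    ext v
    simp only [Set.mem_setOf_eq, Set.mem_image]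
    constructor
    · rintro ⟨D, hD, rfl⟩
      exact ⟨D f, ⟨D, hD, rfl⟩, (h D).symm⟩
    · rintro ⟨w, ⟨D, hD, rfl⟩, rfl⟩
      exact ⟨D, hD, h D⟩
  unfold NuZeroAt
  refine exists_congr fun d => exists_congr fun e => exists_congr fun hed => exists_congr fun t =>
    exists_congr fun b => ?_
  rw [hset, span_image_mul_eq_of_isUnit hu]

/-- In characteristic `p` every derivation kills `p`-th powers, so `D (φ^p · f + g^p) = φ^p · D f`.
[cite: Posva2024, App. A Claim A.1.1] [folklore] -/
theorem derivation_unit_pow_mul_add_pow (p : ℕ) [CharP S p] (D : Derivation ℤ S S) (φ f g : S) :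
    D (φ ^ p * f + g ^ p) = φ ^ p * D f := by
  have hp : ∀ x : S, D (x ^ p) = 0 := fun x => by
    rw [Derivation.leibniz_pow, nsmul_eq_mul, CharP.cast_eq_zero, zero_mul]
  rw [map_add, Derivation.leibniz, hp g, hp φ, smul_zero, add_zero, add_zero, smul_eq_mul]

/-- **Posva 2024, Claim A.1.1, read at a point.**  In characteristic `p`, for a unit `φ` and any `g`,
`NuZeroAt (φ^p · f + g^p) ↔ NuZeroAt f`: Cossart's `𝒥`, `H`, `J`, `ν` «are left unchanged by the substitution
`f ⇝ φ^p f`» (`φ` a unit), and adding a `p`-th power changes no derivative.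
[cite: Posva2024, App. A Claim A.1.1] -/
theorem nuZeroAt_unit_pow_mul_add_pow_iff [IsLocalRing S] (p : ℕ) [CharP S p] {φ : S} (hφ : IsUnit φ)
    (f g : S) : NuZeroAt (φ ^ p * f + g ^ p) ↔ NuZeroAt f :=
  nuZeroAt_iff_of_forall_derivation_eq_mul (hφ.pow p) fun D => derivation_unit_pow_mul_add_pow p D φ f g

/-- Adding a `p`-th power does not change `NuZeroAt` (characteristic `p`). [cite: Posva2024, App. A Claim A.1.1] -/
theorem nuZeroAt_add_pow_iff [IsLocalRing S] (p : ℕ) [CharP S p] (f g : S) :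
    NuZeroAt (f + g ^ p) ↔ NuZeroAt f := by
  have h := nuZeroAt_unit_pow_mul_add_pow_iff p isUnit_one f g
  rwa [one_pow, one_mul] at h

/-- Multiplying by the `p`-th power of a UNIT does not change `NuZeroAt` (characteristic `p`, `p ≠ 0`).
[cite: Posva2024, App. A Claim A.1.1] -/
theorem nuZeroAt_unit_pow_mul_iff [IsLocalRing S] (p : ℕ) [CharP S p] (hp : p ≠ 0) {φ : S}
    (hφ : IsUnit φ) (f : S) : NuZeroAt (φ ^ p * f) ↔ NuZeroAt f := by
  have h := nuZeroAt_unit_pow_mul_add_pow_iff p hφ f 0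
  rwa [zero_pow hp, add_zero] at h

/-- At a regular local ring, if some derivation takes a unit value on `f` (the Jacobian ideal of `f` is the unit
ideal), then `NuZeroAt f` holds, with empty boundary. [folklore] -/
theorem nuZeroAt_of_isUnit_derivation [IsRegularLocalRing S] {f : S}
    (hD : ∃ D : Derivation ℤ S S, IsUnit (D f)) : NuZeroAt f := by
  obtain ⟨t, ht⟩ := exists_regularSystemOfParameters (R := S)
  refine ⟨(maximalIdeal S).spanFinrank, 0, Nat.zero_le _, t, Fin.elim0, ht,
    (IsRegularLocalRing.spanFinrank_maximalIdeal (R := S)).symm, ?_⟩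
  -- both sides are the unit ideal
  have hR : Ideal.span {∏ i : Fin 0, t (Fin.castLE (Nat.zero_le _) i) ^ (Fin.elim0 : Fin 0 → ℕ) i} = ⊤ := by
    rw [Finset.univ_eq_empty, Finset.prod_empty, Ideal.span_singleton_one]
  rw [hR, Ideal.eq_top_iff_one]
  obtain ⟨D, hDf⟩ := hD
  have hmem : D f ∈ Ideal.span {v : S | ∃ D' : Derivation ℤ S S,
      (∀ i : Fin 0, t (Fin.castLE (Nat.zero_le _) i) ∣ D' (t (Fin.castLE (Nat.zero_le _) i))) ∧ D' f = v} :=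
    Ideal.subset_span ⟨D, fun i => i.elim0, rfl⟩
  exact (Ideal.eq_top_of_isUnit_mem _ hmem hDf) ▸ Submodule.mem_top

/-- At a field (e.g. the generic point), `NuZeroAt f` holds as soon as some derivation does not kill `f`.
[folklore] -/
theorem nuZeroAt_of_isField [IsLocalRing S] (hS : IsField S) {f : S}
    (hD : ∃ D : Derivation ℤ S S, D f ≠ 0) : NuZeroAt f := by
  letI := hS.toField
  refine ⟨0, 0, le_rfl, Fin.elim0, Fin.elim0, ?_, ?_, ?_⟩
  · rw [(IsLocalRing.isField_iff_maximalIdeal_eq).mp hS]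
    simp
  · simp
  · have hR : Ideal.span {∏ i : Fin 0, (Fin.elim0 : Fin 0 → S) (Fin.castLE le_rfl i) ^
        (Fin.elim0 : Fin 0 → ℕ) i} = ⊤ := by
      rw [Finset.univ_eq_empty, Finset.prod_empty, Ideal.span_singleton_one]
    rw [hR, Ideal.eq_top_iff_one]
    obtain ⟨D, hDf⟩ := hD
    have hmem : D f ∈ Ideal.span {v : S | ∃ D' : Derivation ℤ S S,
        (∀ i : Fin 0, (Fin.elim0 : Fin 0 → S) (Fin.castLE le_rfl i) ∣
          D' ((Fin.elim0 : Fin 0 → S) (Fin.castLE le_rfl i))) ∧ D' f = v} :=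
      Ideal.subset_span ⟨D, fun i => i.elim0, rfl⟩
    exact (Ideal.eq_top_of_isUnit_mem _ hmem (isUnit_iff_ne_zero.mpr hDf) : _ = ⊤) ▸ Submodule.mem_top

/-- At a discrete valuation ring (a point of codimension one), `NuZeroAt f` holds as soon as some derivation does
not kill `f`: with the uniformizer `ϖ` as the (one-element) regular system of parameters and boundary `e = 1`, the
ideal spanned by the values `D f` of the derivations logarithmic along `ϖ` is non-zero (it contains `ϖ · D₀ f`), hence
equal to `(ϖ ^ b)` for some `b`. [folklore] -/
theorem nuZeroAt_of_isDiscreteValuationRing [IsDomain S] [IsDiscreteValuationRing S] {f : S}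
    (hD : ∃ D : Derivation ℤ S S, D f ≠ 0) : NuZeroAt f := by
  obtain ⟨ϖ, hϖ⟩ := IsDiscreteValuationRing.exists_irreducible S
  obtain ⟨D₀, hD₀⟩ := hD
  -- the log-Jacobian ideal along `ϖ`
  set J : Ideal S := Ideal.span {v : S | ∃ D : Derivation ℤ S S,
      (∀ i : Fin 1, (![ϖ] : Fin 1 → S) (Fin.castLE le_rfl i) ∣
        D ((![ϖ] : Fin 1 → S) (Fin.castLE le_rfl i))) ∧ D f = v} with hJ
  have hJne : J ≠ ⊥ := by
    intro hbot
    have hmem : (ϖ • D₀) f ∈ J := by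
      refine Ideal.subset_span ⟨ϖ • D₀, fun i => ?_, rfl⟩
      have hi : (![ϖ] : Fin 1 → S) (Fin.castLE le_rfl i) = ϖ := by
        fin_cases i; rfl
      rw [hi, Derivation.smul_apply, smul_eq_mul]
      exact dvd_mul_right ϖ _
    rw [hbot, Ideal.mem_bot, Derivation.smul_apply, smul_eq_mul] at hmem
    exact (mul_ne_zero hϖ.ne_zero hD₀) hmem
  obtain ⟨n, hn⟩ := IsDiscreteValuationRing.ideal_eq_span_pow_irreducible hJne hϖ
  refine ⟨1, 1, le_rfl, ![ϖ], ![n], ?_, ?_, ?_⟩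
  · rw [hϖ.maximalIdeal_eq]
    congr 1
    ext x
    simp
  · simpa using IsPrincipalIdealRing.ringKrullDim_eq_one S (IsDiscreteValuationRing.not_isField S)
  · rw [← hJ, hn]
    congr 1
    ext x
    simp


/-- Conversely, in a Noetherian local domain `NuZeroAt f` forces some derivation not to kill `f`: if every `D f` vanished,
the log-Jacobian ideal would be `⊥`, so the monomial `∏ t_i ^ b_i` would vanish, so one member of the regular system
of parameters `t` (with `d = dim S` members) would be `0`, and `𝔪` would be generated by `d - 1` elements — impossible
by Krull's height theorem (`dim S ≤ μ(𝔪)`). [folklore] -/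
theorem exists_derivation_apply_ne_zero_of_nuZeroAt [IsLocalRing S] [IsNoetherianRing S] [IsDomain S] {f : S}
    (h : NuZeroAt f) : ∃ D : Derivation ℤ S S, D f ≠ 0 := by
  by_contra hcon
  push Not at hcon
  obtain ⟨d, e, hed, t, b, ht, hd, hJ⟩ := h
  have hL : Ideal.span {v : S | ∃ D : Derivation ℤ S S,
      (∀ i : Fin e, t (Fin.castLE hed i) ∣ D (t (Fin.castLE hed i))) ∧ D f = v} = ⊥ := by
    rw [Ideal.span_eq_bot]
    rintro v ⟨D, -, rfl⟩
    exact hcon D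
  rw [hL, eq_comm, Ideal.span_singleton_eq_bot] at hJ
  obtain ⟨i, -, hi⟩ := Finset.prod_eq_zero_iff.mp hJ
  have hti : t (Fin.castLE hed i) = 0 := eq_zero_of_pow_eq_zero hi
  -- `0 ∈ range t`, so `𝔪` is generated by at most `d - 1` elements
  have hd1 : 1 ≤ d := Nat.one_le_of_lt (Fin.castLE hed i).isLt
  have hmem : (0 : S) ∈ Set.range t := ⟨_, hti⟩
  have hrange : Set.range t = insert 0 (Set.range t \ {0}) := by
    rw [Set.insert_sdiff_singleton, Set.insert_eq_of_mem hmem]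
  have hspan : maximalIdeal S = Ideal.span (Set.range t \ {0}) := by
    rw [← Ideal.span_insert_zero, ← hrange, ht]
  have hcard : (Set.range t \ {0}).ncard ≤ d - 1 := by
    rw [Set.ncard_sdiff_singleton_of_mem hmem]
    have : (Set.range t).ncard ≤ d := by
      rw [← Set.image_univ]
      exact (Set.ncard_image_le (Set.finite_univ)).trans (by simp [Set.ncard_univ])
    omega
  have hfin : (maximalIdeal S).spanFinrank ≤ d - 1 := by
    rw [hspan]
    exact (Submodule.spanFinrank_span_le_ncard_of_finite ((Set.finite_range t).sdiff)).trans hcard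
  have hdim : ringKrullDim S ≤ ((d - 1 : ℕ) : WithBot ℕ∞) :=
    (ringKrullDim_le_spanFinrank_maximalIdeal S).trans (by exact_mod_cast hfin)
  rw [hd] at hdim
  have : d ≤ d - 1 := by exact_mod_cast hdim
  omega

/-- At a discrete valuation ring, `NuZeroAt f ↔` some derivation does not kill `f`. [folklore] -/
theorem nuZeroAt_iff_of_isDiscreteValuationRing [IsDomain S] [IsDiscreteValuationRing S] (f : S) :
    NuZeroAt f ↔ ∃ D : Derivation ℤ S S, D f ≠ 0 :=
  ⟨exists_derivation_apply_ne_zero_of_nuZeroAt, nuZeroAt_of_isDiscreteValuationRing⟩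

/-- At a field, `NuZeroAt f ↔` some derivation does not kill `f`. [folklore] -/
theorem nuZeroAt_iff_of_isField [IsLocalRing S] (hS : IsField S) (f : S) :
    NuZeroAt f ↔ ∃ D : Derivation ℤ S S, D f ≠ 0 := by
  letI := hS.toField
  exact ⟨exists_derivation_apply_ne_zero_of_nuZeroAt, nuZeroAt_of_isField hS⟩

end Summit.ResolutionOfSingularities.ResolutionOfSingularities.Theorems.RadicialJung.CleanModels.NuZeroAtBasics

end
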